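import Summits.KontsevichZagierPeriods.Zeta5Search.RVFlatGaugeZoneCResidual
import HarnessLib.Audit
import HarnessLib

/-!
# RVFlatGaugeZoneCRows — where the zone-C bonus lives: the two-long-block class law REDUCED TO THE MULTIPOLE-ROW LAW (fam-rv gen 12, file 3; request
#12.3)

HONEST FRAMING: systematic search; no irrationality claim unless certified.  Cell `pub-zeta5`, family `rv`, generation 12.
`p`-adic valuations of rational numbers attached to Brown–Zudilin's auxiliary series; nothing here concerns irrationality.

Gen 11 typed the class law on zone C with the flat-gauge bonus (`TwoLongClassLaw`: `refund − N_p + zcBonus ≤ v_p Cas_j(b)`), file 12.2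
decided it instance-wise wherever the tree's cover fires and isolated the residual (`Γ ≥ 1`, the `¬H(3)` cancellation regime).  This file
locates the bonus inside the Casoratian.  By `ClusterValuation.casoratian_split` and `kRes_eq_sum_classK` (tree, PROVED)

  `Cas_j(b) = [Ω(b⁺)V(b) − Ω(b)V(b⁺)] − Σ_{x mod p} R_x`,  `R_x := 𝒦_x(b⁺)·V(b) − 𝒦_x(b)·V(b⁺)`  (`classRow`; `b⁺ = b + e_j`),

the ROW of the residue class `x` of the `𝒦`-bracket, taken with the FULL constant terms.  Definitions `classRow`, `multiRows` (sum over the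
multipole classes of `b`), `singleRows` (the other classes), the PROVED identities `kBracket_eq_rows`, `casoratian_eq_rows`, TWO typed nodes

* `ZoneCMultiRowLaw`       — (R1) `v_p(Σ_{x multipole} R_x) ≥ refund − N_p + zcBonus` on zone C (OBSERVED; THE carrier of the bonus, TIGHT);
* `ZoneCConstantTermBonus` — (VΓ) `v_p V(c) ≥ −N_p + zcBonus`, `c ∈ {b, b⁺}` (OBSERVED; = THEOREM V when `zcBonus = 0`; certified instance-wise
  by gen 9's `provedCaseZ` through the decidable `vBonusGuard` / `constantTermBonus_of_guard` (PROVED) on 2,701 / 2,704 (`p = 5`) and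
  22,061 / 22,098 (`p = 7`) zone-C instances);

the single-row law (R2) as a THEOREM given (VΓ) — `singleRow_val_of_constantTermBonus`: every class with at most one pole has
`v_p(R_x) ≥ refund − N_p + zcBonus`, termwise (PROVED: `‖𝒦_x‖ ≤ p⁻¹` for such classes, tree) — and the PROVED reduction
`twoLongClassLaw_of_rowLaws : ZoneCMultiRowLaw → ZoneCConstantTermBonus → TwoLongClassLaw` (ultrametric inequality on the identity; `Ω = 0`
for `p ≤ d` by `omegaRes_eq_zero`, `‖Ω‖ ≤ 1` always), hence `twoLongResidual_of_rowLaws` and `flatGaugeLawZoneC_of_rowLaws`; and the CONVERSE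
`zoneCMultiRowLaw_of_twoLongClassLaw :
ZoneCConstantTermBonus → TwoLongClassLaw → ZoneCMultiRowLaw` (PROVED) — modulo (VΓ) the reduction is LOSSLESS.  NET EFFECT: the flat
`S₇`-gauge law on zone C rests on ONE new digit statement, the multipole-row law (R1), plus a constant-term floor of gen 9's type.

WHY ROWS (exact census, `pub-zeta5-fam-rv/gen12/blocks1.py`, `blocks2.py`; engine for the partial fractions = the typer's `code/typer/pfdata.py`,
`v_p Cas` cross-checked against gen 11's independent engine on every instance, identity `Cas = Ω-bracket − Σ_x R_x` asserted exactly):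
on the 848 RESIDUAL instances of file 12.2 at `p = 5` (complete) the multipole-row total (R1) holds 848/848 and is TIGHT in 803 (margin
0 : 803, 1 : 32, 2 : 13) — exactly the 803 instances where the node itself is attained; the single rows hold termwise with margin ≥ 2
(2 : 150, 3 : 47, 4 : 4, no single-pole class : 647); the `Ω`-bracket vanishes in 839 and has margin ≥ 1 in the other 9.  By contrast the
tree's (CV)-cut "multipole BLOCK + mixed pairs" (`MultiBlockLaw`, `MixedPairLaw`, class pieces `V_y` instead of the full `V`) is the WRONG cut
for the bonus: the multi–multi block alone falls one short of the node in 107 of the 848 instances and is rescued by the mixed pairs of the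
same rows (inter-block cancellation), and no cut is termwise (single multipole rows fall short by up to 3 in 428 instances: the multipole
rows cancel among themselves, and NOT by conjugate pairs `{x, b₀ − x}`: grouping the multipole rows into conjugate pairs leaves
the per-instance minimum below the node in the same 428 instances, `blocks3.py`).

CENSUS ON ALL OF ZONE C (not only the residual; exact).  `p = 5`, all 2,704 instances `(b, j)` (`blocks2.py`, complete): (R1) 0 failures,
ATTAINED (margin 0) on 2,072 = 530 of the 805 instances with `Γ ≤ 0` + 1,542 of the 1,899 with `Γ ≥ 1`; (R2) termwise 0 failures (the
minimum over the single-pole classes is attained on 381); (VΓ) 0 failures, attained on 619 instances for `c = b` and on 377 for `c = b⁺`,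
and CERTIFIED from the tree by `vBonusGuard` on 2,701 of the 2,704 (`vbonus_cover.py`; the three others are `b = (12;6,6,6,6,5,3,2)`,
`j ∈ {5,6,7}`, `Γ = 1`, where it holds by value); the `Ω`-bracket is within the node everywhere (margin 0 on 250 instances); every class with at
most one pole has `v_p 𝒦_x(c) ≥ 1` (tree: `singlePoleClassKBound_holds`).  `p = 7` (22,098 zone-C instances): `vBonusGuard` fires on 22,061
(the 37 others all of digit type `(f, ⌊d/p⌋, n₂, n₁, n_big) = (1,0,0,1,5)`, `Γ = 1`); exact valuations on random samples — 500 of all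
22,098 (`blocks2.py`, seed 3): (R1), (R2), (VΓ), `Ω`: 0 failures, (R1) attained on 364, (VΓ) attained on 137 (`c = b`) / 86 (`c = b⁺`);
350 of the 6,342 RESIDUAL instances (`blocks1.py`, seed 11): (R1) 350/350, attained on 336, single rows termwise margin ≥ 1
(1 : 3, 2 : 66, 3 : 25, 4 : 5, none : 251), the multi–multi block alone one short on 45; 1,500 of the 6,342 RESIDUAL instances (`blocks3.py`, seed
5; 5,274 conjugate groups of multipole classes): grouping the multipole rows by conjugate pairs `{x, b₀ − x}` leaves the per-instance minimum BELOW
the node on 883 of them (histogram of the minimum margin -3 : 365, -2 : 216, -1 : 302, 0 : 592, 1 : 17, 2 : 8) — at `p = 7`, too, the multipole rows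
cancel across conjugate pairs.
Outputs: `gen12/out/blocks1_p5.json|log`, `blocks1_p7.log`, `blocks2_p5.json|log`, `blocks2_p7_s500.log`, `blocks3_p5_residual.json`,
`blocks3_p7_res1500.log`, `vbonus_cover_p5_7.json`.  Local compute ≈ 40 core-min, exact `fractions` arithmetic, single processes < 1 GB.
-/

noncomputable section

namespace Summit.KontsevichZagierPeriods.Zeta5Search.RVFlatGauge

open Finset
open Summit.KontsevichZagierPeriods.Zeta5Search.CasoratianValuation (casoratian shift InPolytope pairFloors refund)
open Summit.KontsevichZagierPeriods.Zeta5Search.WedgeDictionary (dOf coeffV)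
open Summit.KontsevichZagierPeriods.Zeta5Search.ClusterValuation
open Summit.KontsevichZagierPeriods.Zeta5Search.PadicSeries
open Cap ZoneC

/-! ### Rows of the `𝒦`-bracket -/

/-- The ROW of the residue class `x` in the `𝒦`-bracket, with the full constant terms: `R_x = 𝒦_x(b⁺)·V(b) − 𝒦_x(b)·V(b⁺)`. -/
def classRow (b : ℕ → ℤ) (j p x : ℕ) : ℚ :=
  classK (shift b j) p x * coeffV b - classK b p x * coeffV (shift b j)

/-- The rows of the MULTIPOLE classes of `b` (at least two poles in the class), summed. -/
def multiRows (b : ℕ → ℤ) (j p : ℕ) : ℚ := ∑ x ∈ multipoleClasses b p, classRow b j p x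

/-- The rows of the classes of `b` with at most one pole, summed. -/
def singleRows (b : ℕ → ℤ) (j p : ℕ) : ℚ :=
  ∑ x ∈ (range p).filter (fun x => ¬ 2 ≤ classPoleCount b p x), classRow b j p x

/-- **The `𝒦`-bracket is the sum of its rows** (PROVED): `𝒦(b⁺)V(b) − 𝒦(b)V(b⁺) = multiRows + singleRows`. -/
theorem kBracket_eq_rows (b : ℕ → ℤ) (j : ℕ) {p : ℕ} (hp : 0 < p) :
    kRes (shift b j) p * coeffV b - kRes b p * coeffV (shift b j) = multiRows b j p + singleRows b j p := by
  unfold multiRows singleRows classRow multipoleClasses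
  rw [kRes_eq_sum_classK (shift b j) hp, kRes_eq_sum_classK b hp, sum_mul, sum_mul, ← sum_sub_distrib,
    ← sum_filter_add_sum_filter_not (range p) (fun x => 2 ≤ classPoleCount b p x)]

/-- **The Casoratian by rows** (PROVED): `Cas_j(b) = [Ω(b⁺)V(b) − Ω(b)V(b⁺)] − (multiRows + singleRows)`. -/
theorem casoratian_eq_rows (b : ℕ → ℤ) (j : ℕ) {p : ℕ} (hp : 0 < p) :
    casoratian b j =
      (omegaRes (shift b j) p * coeffV b - omegaRes b p * coeffV (shift b j)) - (multiRows b j p + singleRows b j p) := by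
  rw [casoratian_split b j p, kBracket_eq_rows b j hp]

/-! ### The two row laws on zone C (typed nodes; zone-C binders verbatim as in gen 11's `TwoLongClassLaw`) -/

/-- **(R1) THE MULTIPOLE-ROW LAW ON ZONE C, OBSERVED** (minted by this cell from an exact census; NOT a published result): the rows of the
multipole classes, summed, carry the class-law level AND the flat-gauge bonus: `v_p(Σ_{x multipole} R_x) ≥ refund − N_p + zcBonus`.
Exact census in the module docstring (0 failures on all 2,704 zone-C instances at `p = 5`; tight on 803 of the 848 residual instances). -/
@[conjecture] def ZoneCMultiRowLaw : Prop :=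
  ∀ (b : ℕ → ℤ) (j p i₁ i₂ : ℕ), InPolytope b → 1 ≤ j → j ≤ 7 → InPolytope (shift b j) → p.Prime → 5 ≤ p →
    b 0 < 3 * (p : ℤ) → i₁ < 7 → i₂ < 7 → i₁ ≠ i₂ → (p : ℤ) ≤ b 0 - 2 * b (i₁ + 1) → (p : ℤ) ≤ b 0 - 2 * b (i₂ + 1) →
    b (i₁ + 1) ≤ b (i₂ + 1) → (∀ k ∈ ((range 7).erase i₁).erase i₂, b 0 - 2 * b (k + 1) < p) → multiRows b j p ≠ 0 →
      refund b p - pairFloors b p + zcBonus b p i₁ i₂ ≤ padicValRat p (multiRows b j p)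

/-- **(VΓ) THE CONSTANT TERMS CARRY THE BONUS ON ZONE C, OBSERVED** (minted by this cell; NOT a published result): `v_p V(c) ≥ −N_p(b) + zcBonus`
for `c ∈ {b, b + e_j}` (no refund).  For `zcBonus = 0` this is THEOREM V (`padicNorm_coeffV_le_pairFloors`); in general it is certified
instance-wise by gen 9's `provedCaseZ` — see `vBonusGuard` / `constantTermBonus_of_guard` below (2,701 / 2,704 instances at `p = 5`,
22,061 / 22,098 at `p = 7`; the rest, all of digit type `(f,⌊d/p⌋,n₂,n₁,n_big) = (1,0,0,1,5)`, `Γ = 1`, hold by value). -/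
@[conjecture] def ZoneCConstantTermBonus : Prop :=
  ∀ (b : ℕ → ℤ) (j p i₁ i₂ : ℕ), InPolytope b → 1 ≤ j → j ≤ 7 → InPolytope (shift b j) → p.Prime → 5 ≤ p →
    b 0 < 3 * (p : ℤ) → i₁ < 7 → i₂ < 7 → i₁ ≠ i₂ → (p : ℤ) ≤ b 0 - 2 * b (i₁ + 1) → (p : ℤ) ≤ b 0 - 2 * b (i₂ + 1) →
    b (i₁ + 1) ≤ b (i₂ + 1) → (∀ k ∈ ((range 7).erase i₁).erase i₂, b 0 - 2 * b (k + 1) < p) →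
      (coeffV b ≠ 0 → -pairFloors b p + zcBonus b p i₁ i₂ ≤ padicValRat p (coeffV b)) ∧
      (coeffV (shift b j) ≠ 0 → -pairFloors b p + zcBonus b p i₁ i₂ ≤ padicValRat p (coeffV (shift b j)))

/-- **(R2) = a THEOREM given (VΓ)** (PROVED): on zone C every class with at most one pole has `v_p(R_x) ≥ refund − N_p + zcBonus`
(termwise) — since `‖𝒦_x(c)‖ ≤ p⁻¹` for `c = b, b⁺` (`padicNorm_classK_le_of_le_one`, `classPoleCount_shift_le`, tree), so
`‖R_x‖ ≤ p⁻¹ · p^{N_p − zcBonus} ≤ p^{−(refund − N_p + zcBonus)}`. -/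
theorem singleRow_val_of_constantTermBonus (h3 : ZoneCConstantTermBonus) (b : ℕ → ℤ) {j p i₁ i₂ x : ℕ} (hb : InPolytope b)
    (hj1 : 1 ≤ j) (hj7 : j ≤ 7) (hb' : InPolytope (shift b j)) (hprime : p.Prime) (hp5 : 5 ≤ p) (hb3 : b 0 < 3 * (p : ℤ))
    (hi₁ : i₁ < 7) (hi₂ : i₂ < 7) (hne12 : i₁ ≠ i₂)
    (hL₁ : (p : ℤ) ≤ b 0 - 2 * b (i₁ + 1)) (hL₂ : (p : ℤ) ≤ b 0 - 2 * b (i₂ + 1)) (hle : b (i₁ + 1) ≤ b (i₂ + 1))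
    (hshort : ∀ k ∈ ((range 7).erase i₁).erase i₂, b 0 - 2 * b (k + 1) < p)
    (hx : x < p) (hlex : classPoleCount b p x ≤ 1) (hne : classRow b j p x ≠ 0) :
    refund b p - pairFloors b p + zcBonus b p i₁ i₂ ≤ padicValRat p (classRow b j p x) := by
  haveI : Fact p.Prime := ⟨hprime⟩
  have hp1 : (1 : ℚ) < p := by exact_mod_cast hprime.one_lt
  have hwin : (b 0 + 2 : ℤ) < (p : ℤ) ^ 2 := win_of_lt_three_p hp5 hb3
  have hwin' : (shift b j 0 + 2 : ℤ) < (p : ℤ) ^ 2 := by rwa [BigPrime.shift_zero b hj1]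
  have hK : padicNorm p (classK b p x) ≤ (p : ℚ) ^ (-(1 : ℤ)) := padicNorm_classK_le_of_le_one b hb hp5 hwin hx hlex
  have hK' : padicNorm p (classK (shift b j) p x) ≤ (p : ℚ) ^ (-(1 : ℤ)) :=
    padicNorm_classK_le_of_le_one (shift b j) hb' hp5 hwin' hx ((classPoleCount_shift_le b hb.1 hj1 p x).trans hlex)
  obtain ⟨hVb, hVb'⟩ := h3 b j p i₁ i₂ hb hj1 hj7 hb' hprime hp5 hb3 hi₁ hi₂ hne12 hL₁ hL₂ hle hshort
  have hV : padicNorm p (coeffV b) ≤ (p : ℚ) ^ (-(-pairFloors b p + zcBonus b p i₁ i₂)) := padicNorm_le_of_val hVb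
  have hV' : padicNorm p (coeffV (shift b j)) ≤ (p : ℚ) ^ (-(-pairFloors b p + zcBonus b p i₁ i₂)) := padicNorm_le_of_val hVb'
  have hr1 : refund b p ≤ 1 := min_le_left _ _
  apply val_ge_of_padicNorm_le hne
  unfold classRow
  refine ((padicNorm.sub (p := p)).trans (max_le (padicNorm_mul_le hK' hV) (padicNorm_mul_le hK hV'))).trans ?_
  exact zpow_le_zpow_right₀ hp1.le (by omega)

/-! ### (VΓ) instance-wise from the tree: a decidable guard -/

/-- Decidable certificate for (VΓ) at bonus `δ`: `δ ≤ 0` (THEOREM V) or gen 9's `provedCaseZ` for both `b` and `b + e_j` at level `−N_p + δ`. -/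
def vBonusGuard (b : ℕ → ℤ) (j p : ℕ) (δ : ℤ) : Bool :=
  decide (δ ≤ 0) || (provedCaseZ b p (-pairFloors b p + δ) && provedCaseZ (shift b j) p (-pairFloors b p + δ))

/-- **Soundness of `vBonusGuard`** (PROVED): the constant terms of `b` and `b + e_j` have `v_p ≥ −N_p(b) + δ`. -/
theorem constantTermBonus_of_guard (b : ℕ → ℤ) {j p : ℕ} (hb : InPolytope b) (hj1 : 1 ≤ j) (hb' : InPolytope (shift b j))
    (hprime : p.Prime) (hp5 : 5 ≤ p) (hwin : (b 0 + 2 : ℤ) < (p : ℤ) ^ 2) {δ : ℤ} (hg : vBonusGuard b j p δ = true) :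
    (coeffV b ≠ 0 → -pairFloors b p + δ ≤ padicValRat p (coeffV b)) ∧
      (coeffV (shift b j) ≠ 0 → -pairFloors b p + δ ≤ padicValRat p (coeffV (shift b j))) := by
  haveI : Fact p.Prime := ⟨hprime⟩
  have hp1 : (1 : ℚ) < p := by exact_mod_cast hprime.one_lt
  have hwin' : (shift b j 0 + 2 : ℤ) < (p : ℤ) ^ 2 := by rwa [BigPrime.shift_zero b hj1]
  have hN' : pairFloors (shift b j) p ≤ pairFloors b p := pairFloors_shift_le b hj1 p hprime.pos
  simp only [vBonusGuard, Bool.or_eq_true, Bool.and_eq_true, decide_eq_true_eq] at hg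
  rcases hg with hδ | ⟨hz, hz'⟩
  · refine ⟨fun hne => val_ge_of_padicNorm_le hne ?_, fun hne => val_ge_of_padicNorm_le hne ?_⟩
    · exact (padicNorm_coeffV_le_pairFloors b hb hp5 hwin).trans (zpow_le_zpow_right₀ hp1.le (by omega))
    · exact (padicNorm_coeffV_le_pairFloors (shift b j) hb' hp5 hwin').trans (zpow_le_zpow_right₀ hp1.le (by omega))
  · exact ⟨fun hne => val_ge_of_provedCaseZ b hb hp5 hwin hz hne, fun hne => val_ge_of_provedCaseZ (shift b j) hb' hp5 hwin' hz' hne⟩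

/-- (VΓ) at every zone-C instance where the guard fires at `δ = zcBonus` (PROVED). -/
theorem zoneCConstantTermBonus_of_guard (b : ℕ → ℤ) {j p i₁ i₂ : ℕ} (hb : InPolytope b) (hj1 : 1 ≤ j)
    (hb' : InPolytope (shift b j)) (hprime : p.Prime) (hp5 : 5 ≤ p) (hb3 : b 0 < 3 * (p : ℤ))
    (hg : vBonusGuard b j p (zcBonus b p i₁ i₂) = true) :
    (coeffV b ≠ 0 → -pairFloors b p + zcBonus b p i₁ i₂ ≤ padicValRat p (coeffV b)) ∧
      (coeffV (shift b j) ≠ 0 → -pairFloors b p + zcBonus b p i₁ i₂ ≤ padicValRat p (coeffV (shift b j))) :=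
  constantTermBonus_of_guard b hb hj1 hb' hprime hp5 (win_of_lt_three_p hp5 hb3) hg

/-! ### The reduction (PROVED) and its converse -/

/-- The `Ω`-bracket is within the node on zone C, given (VΓ) at the instance: for `p ≤ d` both residue sums vanish (`omegaRes_eq_zero`);
for `d < p` they are `p`-integral (`padicNorm_omegaRes_le_one`), `refund = 0`, and the constant terms carry the bonus. -/
theorem padicNorm_omegaBracket_le (b : ℕ → ℤ) {j p i₁ i₂ : ℕ} (hb : InPolytope b) (hj1 : 1 ≤ j) (hj7 : j ≤ 7)
    (hb' : InPolytope (shift b j)) (hprime : p.Prime) (hp5 : 5 ≤ p)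
    (hV : (coeffV b ≠ 0 → -pairFloors b p + zcBonus b p i₁ i₂ ≤ padicValRat p (coeffV b)) ∧
      (coeffV (shift b j) ≠ 0 → -pairFloors b p + zcBonus b p i₁ i₂ ≤ padicValRat p (coeffV (shift b j)))) :
    haveI : Fact p.Prime := ⟨hprime⟩
    padicNorm p (omegaRes (shift b j) p * coeffV b - omegaRes b p * coeffV (shift b j)) ≤
      (p : ℚ) ^ (-(refund b p - pairFloors b p + zcBonus b p i₁ i₂)) := by
  haveI : Fact p.Prime := ⟨hprime⟩
  have hdshift : dOf (shift b j) = dOf b - 1 := BigPrime.dOf_shift b hj1 hj7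
  by_cases hpd : (p : ℤ) ≤ dOf b
  · rw [omegaRes_eq_zero b hb (by omega), omegaRes_eq_zero (shift b j) hb' (by rw [hdshift]; omega), zero_mul, zero_mul,
      sub_zero, padicNorm.zero]
    exact zpow_p_nonneg _
  · have hd0 : 0 ≤ dOf b := by
      have := hb.2.2; unfold dOf; linarith
    have hr : refund b p = 0 := by
      unfold refund
      rw [Int.ediv_eq_zero_of_lt hd0 (by omega)]; simp
    obtain ⟨hVb, hVb'⟩ := hV
    rw [hr, zero_sub]
    have hVn : padicNorm p (coeffV b) ≤ (p : ℚ) ^ (-(-pairFloors b p + zcBonus b p i₁ i₂)) := padicNorm_le_of_val hVb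
    have hVn' : padicNorm p (coeffV (shift b j)) ≤ (p : ℚ) ^ (-(-pairFloors b p + zcBonus b p i₁ i₂)) := padicNorm_le_of_val hVb'
    have hΩint : ∀ b' : ℕ → ℤ, InPolytope b' → padicNorm p (omegaRes b' p) ≤ 1 := fun b' hb'' =>
      padicNorm_omegaRes_le_one b' hb'' (by omega)
    refine (padicNorm.sub (p := p)).trans (max_le ?_ ?_)
    · rw [padicNorm.mul]
      calc padicNorm p (omegaRes (shift b j) p) * padicNorm p (coeffV b) ≤ 1 * (p : ℚ) ^ (-(-pairFloors b p + zcBonus b p i₁ i₂)) :=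
            mul_le_mul (hΩint _ hb') hVn (padicNorm.nonneg _) zero_le_one
        _ = _ := one_mul _
    · rw [padicNorm.mul]
      calc padicNorm p (omegaRes b p) * padicNorm p (coeffV (shift b j)) ≤ 1 * (p : ℚ) ^ (-(-pairFloors b p + zcBonus b p i₁ i₂)) :=
            mul_le_mul (hΩint _ hb) hVn' (padicNorm.nonneg _) zero_le_one
        _ = _ := one_mul _

/-- The single rows, summed, are within the node (given (VΓ): (R2) termwise + ultrametric). -/
theorem padicNorm_singleRows_le (h3 : ZoneCConstantTermBonus) (b : ℕ → ℤ) {j p i₁ i₂ : ℕ} (hb : InPolytope b) (hj1 : 1 ≤ j)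
    (hj7 : j ≤ 7) (hb' : InPolytope (shift b j)) (hprime : p.Prime) (hp5 : 5 ≤ p) (hb3 : b 0 < 3 * (p : ℤ))
    (hi₁ : i₁ < 7) (hi₂ : i₂ < 7) (hne12 : i₁ ≠ i₂)
    (hL₁ : (p : ℤ) ≤ b 0 - 2 * b (i₁ + 1)) (hL₂ : (p : ℤ) ≤ b 0 - 2 * b (i₂ + 1)) (hle : b (i₁ + 1) ≤ b (i₂ + 1))
    (hshort : ∀ k ∈ ((range 7).erase i₁).erase i₂, b 0 - 2 * b (k + 1) < p) :
    haveI : Fact p.Prime := ⟨hprime⟩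
    padicNorm p (singleRows b j p) ≤ (p : ℚ) ^ (-(refund b p - pairFloors b p + zcBonus b p i₁ i₂)) := by
  haveI : Fact p.Prime := ⟨hprime⟩
  refine padicNorm.sum_le' (fun x hx => ?_) (zpow_p_nonneg _)
  obtain ⟨hxr, hxm⟩ := mem_filter.1 hx
  exact padicNorm_le_of_val fun hne' =>
    singleRow_val_of_constantTermBonus h3 b hb hj1 hj7 hb' hprime hp5 hb3 hi₁ hi₂ hne12 hL₁ hL₂ hle hshort (mem_range.1 hxr) (by omega) hne'

/-- **Row laws ⇒ gen 11's two-long-block class law.**  `TwoLongClassLaw` follows from (R1) and (VΓ): the Casoratian is the `Ω`-bracket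
minus the rows (`casoratian_eq_rows`); the `Ω`-bracket is within the node (`padicNorm_omegaBracket_le`), the multipole rows are (R1) and the
other rows are bounded termwise by (R2), a consequence of (VΓ). -/
theorem twoLongClassLaw_of_rowLaws (h1 : ZoneCMultiRowLaw) (h3 : ZoneCConstantTermBonus) : TwoLongClassLaw := by
  intro b j p i₁ i₂ hb hj1 hj7 hb' hprime hp5 hb3 hi₁ hi₂ hne12 hL₁ hL₂ hle hshort hcas
  haveI : Fact p.Prime := ⟨hprime⟩
  have hM : padicNorm p (multiRows b j p) ≤ (p : ℚ) ^ (-(refund b p - pairFloors b p + zcBonus b p i₁ i₂)) :=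
    padicNorm_le_of_val fun hne' => h1 b j p i₁ i₂ hb hj1 hj7 hb' hprime hp5 hb3 hi₁ hi₂ hne12 hL₁ hL₂ hle hshort hne'
  have hS := padicNorm_singleRows_le h3 b hb hj1 hj7 hb' hprime hp5 hb3 hi₁ hi₂ hne12 hL₁ hL₂ hle hshort
  have hΩ := padicNorm_omegaBracket_le b hb hj1 hj7 hb' hprime hp5 (h3 b j p i₁ i₂ hb hj1 hj7 hb' hprime hp5 hb3 hi₁ hi₂ hne12 hL₁ hL₂ hle hshort)
  apply val_ge_of_padicNorm_le hcas
  rw [casoratian_eq_rows b j hprime.pos]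
  exact (padicNorm.sub (p := p)).trans (max_le hΩ ((padicNorm.nonarchimedean (p := p)).trans (max_le hM hS)))

/-- **The converse: the reduction is lossless** (PROVED).  Given (VΓ), the two-long-block class law gives back the multipole-row law:
`Σ_{x multipole} R_x = Ω-bracket − Cas − Σ_{x single} R_x` and all three are within the node.  So, modulo the constant-term floor (VΓ),
(R1) is EXACTLY the content of `TwoLongClassLaw` / `TwoLongResidual` — relocated to a sum of `#(multipole classes) ≤ p` explicit rows. -/
theorem zoneCMultiRowLaw_of_twoLongClassLaw (h3 : ZoneCConstantTermBonus) (hT : TwoLongClassLaw) : ZoneCMultiRowLaw := by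
  intro b j p i₁ i₂ hb hj1 hj7 hb' hprime hp5 hb3 hi₁ hi₂ hne12 hL₁ hL₂ hle hshort hne
  haveI : Fact p.Prime := ⟨hprime⟩
  have hC : padicNorm p (casoratian b j) ≤ (p : ℚ) ^ (-(refund b p - pairFloors b p + zcBonus b p i₁ i₂)) :=
    padicNorm_le_of_val fun hc => hT b j p i₁ i₂ hb hj1 hj7 hb' hprime hp5 hb3 hi₁ hi₂ hne12 hL₁ hL₂ hle hshort hc
  have hS := padicNorm_singleRows_le h3 b hb hj1 hj7 hb' hprime hp5 hb3 hi₁ hi₂ hne12 hL₁ hL₂ hle hshort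
  have hΩ := padicNorm_omegaBracket_le b hb hj1 hj7 hb' hprime hp5 (h3 b j p i₁ i₂ hb hj1 hj7 hb' hprime hp5 hb3 hi₁ hi₂ hne12 hL₁ hL₂ hle hshort)
  have heq : multiRows b j p =
      (omegaRes (shift b j) p * coeffV b - omegaRes b p * coeffV (shift b j)) - casoratian b j - singleRows b j p := by
    rw [casoratian_eq_rows b j hprime.pos]; ring
  apply val_ge_of_padicNorm_le hne
  rw [heq]
  exact (padicNorm.sub (p := p)).trans (max_le ((padicNorm.sub (p := p)).trans (max_le hΩ hC)) hS)

/-- **Row laws ⇒ the residual node of file 12.2.** -/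
theorem twoLongResidual_of_rowLaws (h1 : ZoneCMultiRowLaw) (h3 : ZoneCConstantTermBonus) : TwoLongResidual :=
  residual_of_twoLongClassLaw (twoLongClassLaw_of_rowLaws h1 h3)

/-- **Row laws ⇒ the flat `S₇`-gauge law on zone C.** -/
theorem flatGaugeLawZoneC_of_rowLaws (h1 : ZoneCMultiRowLaw) (h3 : ZoneCConstantTermBonus) : FlatGaugeLawZoneC :=
  flatGaugeLawZoneC_of_twoLongClassLaw (twoLongClassLaw_of_rowLaws h1 h3)

/-! ### Kernel instances of the (VΓ) guard -/

/-- The guard fires at the bonus on both examples of file 12.2 (`bR1` at `j = 5`: zero-layer / counting certificates at `−N_5 + 1 = −5`;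
`bR2` at `j = 2`, level `−8`), so (VΓ) is a theorem there; the multipole rows (R1) are what remains at `bR2`. -/
theorem vBonusGuard_examples : vBonusGuard bR1 5 5 1 = true ∧ vBonusGuard bR2 2 5 1 = true := by
  refine ⟨?_, ?_⟩ <;> decide

end Summit.KontsevichZagierPeriods.Zeta5Search.RVFlatGauge

end
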